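import Summits.BirchSwinnertonDyer.Rank1Residual.ManinAdditive.PlusIndexLaws
import Summits.BirchSwinnertonDyer.Rank1Residual.ManinAdditive.Gamma1LatticeBalancedCuspDifferencesPrime
import Summits.BirchSwinnertonDyer.Rank1Residual.ManinAdditive.KatoCurvePlusDefectLevers
import Literature.NumberTheory.EllipticCurves.SkinnerUrban2014.PAdicUnitPeriodRatioAnyPrimeProofs
import Literature.NumberTheory.EllipticCurves.PAdicLFunctionTameIntegralityAtTwoSharedPrimesProofs
import Literature.NumberTheory.EllipticCurves.PAdicLFunctionIntegralityProofs
import Literature.NumberTheory.EllipticCurves.PAdicLFunctionDistributionProofs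
import Literature.NumberTheory.EllipticCurves.PAdicLFunctionProofs
import Literature.NumberTheory.EllipticCurves.ModularSymbolsProofs
import Literature.NumberTheory.EllipticCurves.ModularFormsGamma0Genus
import Literature.NumberTheory.EllipticCurves.ManinConstantGamma1ModularDegree
import Mathlib.NumberTheory.DirichletCharacter.Orthogonality
import Literature.RingTheory.ZeroDimensional.IntegralShapeLemma
import HarnessLib
import HarnessLib.Audit.Tags

/-!
# Plus coordinates, cusp values and the FOURIER UNIT LEMMA for twisted symbol sums (es g22 THEOREM 87♭ machinery)

Cell `bsd-f2-manin` (D-0131 (3) frontier: the Manin constant at additive primes), lens es (Euler systems / explicit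
reciprocity), planner es g22 MEMO-es §36.5/§36.12/§36.13; landed by the cell typer g14 (T-es-29 (c′)(g), 2026-08-28)
VERBATIM from HOME/es/Sketch-es-g22-thm87.lean sha16 793791e5e4546a7e: its `section Helpers` (file lines 51–166), the
three prime-conductor character lemmas of `section Main` (lines 170–190) and the generic part of §U (`cuspValue_natCast`,
`exists_unitTwist_of_fourier`, lines 459–538); namespace `BsdF2ManinEsG22T` ↦ `…ManinAdditive.KatoCurve`.  EVERYTHING
HERE IS A SORRY-FREE THEOREM (no law, no fact): plus coordinates `z + z̄ ∈ ℤ·Ω⁺_f` of periods, cusp values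
`{∞, x/ℓ}` on `ZMod ℓ`, the orthogonality identity `Σ_χ χ(a⁻¹)·S_χ = φ(ℓ)·{∞, a/ℓ}`, integrality of character values,
`ℤ̄ ∩ ℚ = ℤ` (the tree's `Literature.RingTheory.ZeroDimensional.exists_int_of_isIntegral_ratCast`, reused), and the **FOURIER UNIT LEMMA** `exists_unitTwist_of_fourier`: at a conductor `ℓ` with `3 ∤ φ(ℓ)`, an
integral combination of character values supported on a class `P` resolving `φ(ℓ)·j·Ω⁺ = Σ_χ c(χ)·S_χ` with `3 ∤ j`
yields some `χ ∈ P` with `s·S_χ/(3Ω⁺) ∉ ℤ̄` for all `s ⊥ 3` — the number-field-free heart of THEOREM 87♭ (`s = ∏ s_χ`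
trick).  NOT LANDED from the same sketch (DEDUP): `exists_prime_tameUnitTwist` / `tameUnitTwistOfPlusIndexPrimeToThree_holds`
/ `oddTameUnitTwist_of_four_dvd` — E-es-87♭ and E-es-87♭⁺|₄ are already tree theorems by prover p3
(`Summit.BirchSwinnertonDyer.BirchSwinnertonDyer.Theorems.ManinLocalTwoThree.tameUnitTwistOfPlusIndexPrimeToThree`,
`…oddTameUnitTwistOfPlusIndexPrimeToThree_of_four_dvd`, p664349/p663781).  Consumer: `DegeneracyClassUnitTwist.lean`
(THEOREM U♮).  REF1 R-es-44 (§R87: THEOREM 87♭ file v1 61fd9717557842b3 re-elaborated, CONFIRMED; v2 scope pending).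
bears_on: stmt-BirchSwinnertonDyer-22968.  BSD is not proved by this; Manin's conjecture is not proved by this.
-/

noncomputable section

open scoped Classical MatrixGroups ModularForm ComplexConjugate

open CongruenceSubgroup Complex Literature.NumberTheory.EllipticCurves
  Literature.NumberTheory.EllipticCurves.ModularForms
open Summit.BirchSwinnertonDyer.Rank1Residual.ManinAdditive.KatoCurve
open Summit.BirchSwinnertonDyer.Rank1Residual.ManinAdditive.Gamma1Lattice

namespace Summit.BirchSwinnertonDyer.Rank1Residual.ManinAdditive.KatoCurve

section Helpers

variable {N : ℕ} [NeZero N] (f : CuspForm (Gamma0 N) 2)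

omit [NeZero N] in
/-- Plus coordinates: every period has `z + z̄ ∈ ℤ·Ω⁺_f`. -/
theorem exists_add_conj_eq_int_mul
    (hre : realPeriods f = AddSubgroup.zmultiples (plusPeriod f / 2)) {z : ℂ}
    (hz : z ∈ periodLattice f) : ∃ k : ℤ, z + conj z = (k : ℂ) * (plusPeriod f : ℂ) := by
  have hmem : z.re ∈ realPeriods f := AddSubgroup.mem_map.mpr ⟨z, hz, rfl⟩
  rw [hre, AddSubgroup.mem_zmultiples_iff] at hmem
  obtain ⟨k, hk⟩ := hmem
  refine ⟨k, ?_⟩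
  rw [Complex.add_conj]
  have : 2 * z.re = (k : ℝ) * plusPeriod f := by rw [← hk, zsmul_eq_mul]; ring
  rw [this]; push_cast; ring

omit [NeZero N] in
/-- There is a period with plus coordinate exactly `Ω⁺_f`. -/
theorem exists_mem_add_conj_eq
    (hre : realPeriods f = AddSubgroup.zmultiples (plusPeriod f / 2)) :
    ∃ x ∈ periodLattice f, x + conj x = (plusPeriod f : ℂ) := by
  have hmem : plusPeriod f / 2 ∈ realPeriods f := by
    rw [hre]; exact AddSubgroup.mem_zmultiples _
  obtain ⟨x, hx, hxre⟩ := AddSubgroup.mem_map.mp hmem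
  refine ⟨x, hx, ?_⟩
  rw [Complex.add_conj]
  have hxre' : x.re = plusPeriod f / 2 := hxre
  rw [hxre']; push_cast; ring

omit [NeZero N] in
/-- If every generator has plus coordinate in `3ℤ·Ω`, so does every element of the closure. -/
theorem add_conj_mem_three_of_closure {S : Set ℂ} {Ω : ℂ}
    (hS : ∀ g ∈ S, ∃ k : ℤ, g + conj g = 3 * (k : ℂ) * Ω) {y : ℂ} (hy : y ∈ AddSubgroup.closure S) :
    ∃ k : ℤ, y + conj y = 3 * (k : ℂ) * Ω := by
  induction hy using AddSubgroup.closure_induction with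
  | mem x hx => exact hS x hx
  | zero => exact ⟨0, by simp⟩
  | add x y _ _ hx hy =>
    obtain ⟨k, hk⟩ := hx
    obtain ⟨k', hk'⟩ := hy
    refine ⟨k + k', ?_⟩
    rw [map_add]; push_cast
    linear_combination hk + hk'
  | neg x _ hx =>
    obtain ⟨k, hk⟩ := hx
    refine ⟨-k, ?_⟩
    rw [map_neg]; push_cast
    linear_combination -hk

/-- `{∞, r₁}_f = {∞, r₂}_f` when `r₁ − r₂ ∈ ℤ`. -/
theorem modularSymbol_eq_of_eq_add_int {r₁ r₂ : ℚ} {n : ℤ} (h : r₁ = r₂ + n) :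
    modularSymbol f r₁ = modularSymbol f r₂ := by
  rw [h]; exact modularSymbol_add_intCast_holds f r₂ n

/-- The summand `{∞, x.val/ℓ}_f` of the twisted symbol sum. -/
def cuspValue (ℓ : ℕ) (x : ZMod ℓ) : ℂ := modularSymbol f ((x.val : ℚ) / ℓ)

/-- `{∞, b̄.val/ℓ} = {∞, b/ℓ}` for an integer `b`. -/
theorem cuspValue_intCast {ℓ : ℕ} [NeZero ℓ] (b : ℤ) :
    cuspValue f ℓ (b : ZMod ℓ) = modularSymbol f ((b : ℚ) / (ℓ : ℤ)) := by
  unfold cuspValue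
  refine modularSymbol_eq_of_eq_add_int f (n := -(b / ℓ)) ?_
  have hℓ : (ℓ : ℚ) ≠ 0 := by exact_mod_cast NeZero.ne ℓ
  have hv : (((b : ZMod ℓ).val : ℤ) : ℚ) = ((b % ℓ : ℤ) : ℚ) := by
    exact_mod_cast ZMod.val_intCast b
  have hmod : ((b % ℓ : ℤ) : ℚ) = (b : ℚ) - (ℓ : ℚ) * ((b / ℓ : ℤ) : ℚ) := by
    rw [Int.emod_def]; push_cast; ring
  have : (((b : ZMod ℓ).val : ℕ) : ℚ) = (((b : ZMod ℓ).val : ℤ) : ℚ) := by push_cast; rfl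
  rw [this, hv, hmod]
  push_cast
  field_simp
  ring

/-- `{∞, (−x).val/ℓ} = conj {∞, x.val/ℓ}` for `f` with real coefficients. -/
theorem cuspValue_neg (hreal : ∀ n, (cuspCoeff f n).im = 0) {ℓ : ℕ} [NeZero ℓ] (x : ZMod ℓ) :
    cuspValue f ℓ (-x) = conj (cuspValue f ℓ x) := by
  unfold cuspValue
  rw [← modularSymbol_neg_eq_conj_holds f hreal]
  by_cases hx : x = 0
  · subst hx; simp
  · refine modularSymbol_eq_of_eq_add_int f (n := 1) ?_
    have hℓ : (ℓ : ℚ) ≠ 0 := by exact_mod_cast NeZero.ne ℓ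
    rw [ZMod.neg_val, if_neg hx, Nat.cast_sub (ZMod.val_lt x).le]
    push_cast
    field_simp
    ring

omit [NeZero N] in
/-- ORTHOGONALITY: `Σ_χ χ(a⁻¹)·S_χ = φ(ℓ)·{∞, a.val/ℓ}` for a unit `a`. -/
theorem sum_char_inv_mul_twistedSymbolSum {ℓ : ℕ} [NeZero ℓ] {a : ZMod ℓ} (ha : IsUnit a) :
    ∑ χ : DirichletCharacter ℂ ℓ, χ a⁻¹ * twistedSymbolSum f χ
      = (ℓ.totient : ℂ) * cuspValue f ℓ a := by
  unfold twistedSymbolSum cuspValue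
  simp_rw [Finset.mul_sum, ← mul_assoc]
  rw [Finset.sum_comm]
  simp_rw [← Finset.sum_mul, DirichletCharacter.sum_char_inv_mul_char_eq ℂ ha]
  simp [Finset.sum_ite_eq]

/-- Values of a Dirichlet character are algebraic integers. -/
theorem isIntegral_apply {ℓ : ℕ} [NeZero ℓ] (χ : DirichletCharacter ℂ ℓ) (x : ZMod ℓ) :
    IsIntegral ℤ (χ x) := by
  by_cases hx : IsUnit x
  · refine IsIntegral.of_pow (orderOf_pos χ) ?_
    rw [← MulChar.pow_apply' χ (orderOf_pos χ).ne', pow_orderOf_eq_one, MulChar.one_apply hx]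
    exact isIntegral_one
  · rw [χ.map_nonunit hx]; exact isIntegral_zero

-- `exists_int_of_isIntegral_ratCast` (ℤ̄ ∩ ℚ = ℤ) of the es sketch is the tree's
-- `Literature.RingTheory.ZeroDimensional.exists_int_of_isIntegral_ratCast` (IntegralShapeLemma.lean); reused, not restated.

end Helpers

section PrimeConductor


/-- For a Dirichlet character mod a prime `ℓ`: `χ ≠ 1` is primitive. -/
theorem isPrimitive_of_ne_one_prime {ℓ : ℕ} [NeZero ℓ] (hℓ : ℓ.Prime) {χ : DirichletCharacter ℂ ℓ}
    (hχ : χ ≠ 1) : χ.IsPrimitive := by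
  rcases (Nat.dvd_prime hℓ).mp (DirichletCharacter.conductor_dvd_level χ) with h | h
  · exact absurd (DirichletCharacter.eq_one_iff_conductor_eq_one.mpr h) hχ
  · exact h

/-- For a Dirichlet character mod a prime `ℓ`: `orderOf χ ∣ ℓ − 1`. -/
theorem orderOf_dvd_sub_one_prime {ℓ : ℕ} [NeZero ℓ] (hℓ : ℓ.Prime) (χ : DirichletCharacter ℂ ℓ) :
    orderOf χ ∣ ℓ - 1 := by
  have h := orderOf_dvd_card (x := χ)
  rwa [← Nat.card_eq_fintype_card, DirichletCharacter.card_eq_totient_of_hasEnoughRootsOfUnity ℂ ℓ,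
    Nat.totient_prime hℓ] at h

/-- A character that is not even is odd (values in `ℂ`). -/
theorem apply_neg_one_eq_neg_one_of_not_even {ℓ : ℕ} [NeZero ℓ] {χ : DirichletCharacter ℂ ℓ}
    (h : ¬ χ.Even) : χ (-1) = -1 := by
  have hsq : χ (-1) * χ (-1) = 1 := by rw [← map_mul]; simp
  rcases mul_self_eq_one_iff.mp hsq with h1 | h1
  · exact absurd h1 h
  · exact h1

end PrimeConductor

section Fourier

variable {N : ℕ} (f : CuspForm (Gamma0 N) 2)

/-- `{∞, b̄.val/ℓ} = {∞, b/ℓ}` for a natural number `b`. -/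
theorem cuspValue_natCast [NeZero N] {ℓ : ℕ} [NeZero ℓ] (b : ℕ) :
    cuspValue f ℓ (b : ZMod ℓ) = modularSymbol f ((b : ℚ) / ℓ) := by
  have h := cuspValue_intCast f (ℓ := ℓ) (b : ℤ)
  push_cast at h
  exact h

/-- **FOURIER UNIT LEMMA (generic form of the heart of THEOREM 87♭).**  At a prime-power-free conductor `ℓ` with
`3 ∤ φ(ℓ)`: if an integral combination `c` of character values, vanishing off the class `P`, resolves
`φ(ℓ)·j·Ω⁺ = Σ_χ c(χ)·S_χ` with `3 ∤ j`, then some `χ ∈ P` has `s·S_χ/(3Ω⁺) ∉ ℤ̄` for every `s ⊥ 3`. -/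
theorem exists_unitTwist_of_fourier [NeZero N] {ℓ : ℕ} [NeZero ℓ] (h3tot : ¬ (3 : ℤ) ∣ (ℓ.totient : ℤ))
    (hΩC : (plusPeriod f : ℂ) ≠ 0) (P : DirichletCharacter ℂ ℓ → Prop) (c : DirichletCharacter ℂ ℓ → ℂ)
    (hcI : ∀ χ, P χ → IsIntegral ℤ (c χ)) (hc0 : ∀ χ, ¬ P χ → c χ = 0) {j : ℤ} (hj3 : ¬ (3 : ℤ) ∣ j)
    (hE : (ℓ.totient : ℂ) * ((j : ℂ) * (plusPeriod f : ℂ))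
      = ∑ χ : DirichletCharacter ℂ ℓ, c χ * twistedSymbolSum f χ) :
    ∃ χ : DirichletCharacter ℂ ℓ, P χ ∧
      ∀ s : ℕ, ¬ 3 ∣ s → ¬ IsIntegral ℤ ((s : ℂ) * (twistedSymbolSum f χ / (plusPeriod f : ℂ)) / 3) := by
  classical
  by_contra hnone
  push Not at hnone
  choose! sf hsf3 hsfint using hnone
  set sfun : DirichletCharacter ℂ ℓ → ℕ := fun χ => if P χ then sf χ else 1 with hsfun
  have hsfun3 : ∀ χ, ¬ 3 ∣ sfun χ := by
    intro χ
    show ¬ 3 ∣ (if P χ then sf χ else 1)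
    by_cases h : P χ
    · rw [if_pos h]; exact hsf3 χ h
    · rw [if_neg h]; decide
  set s : ℕ := ∏ χ, sfun χ with hsdef
  have hs3 : ¬ 3 ∣ s := by
    rw [hsdef]
    intro h
    obtain ⟨χ, -, hχ⟩ := (Prime.dvd_finsetProd_iff Nat.prime_three.prime _).mp h
    exact hsfun3 χ hχ
  have hint : ∀ χ : DirichletCharacter ℂ ℓ, P χ →
      IsIntegral ℤ ((s : ℂ) * (twistedSymbolSum f χ / (plusPeriod f : ℂ)) / 3) := by
    intro χ hP
    have hsplit : s = sfun χ * ∏ χ' ∈ Finset.univ.erase χ, sfun χ' := by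
      rw [hsdef, ← Finset.mul_prod_erase _ _ (Finset.mem_univ χ)]
    have hsfχ : sfun χ = sf χ := by
      show (if P χ then sf χ else 1) = sf χ
      rw [if_pos hP]
    rw [hsplit]
    push_cast
    have : ((sf χ : ℂ) * ∏ χ' ∈ Finset.univ.erase χ, (sfun χ' : ℂ)) *
        (twistedSymbolSum f χ / (plusPeriod f : ℂ)) / 3
        = (∏ χ' ∈ Finset.univ.erase χ, (sfun χ' : ℂ)) *
          ((sf χ : ℂ) * (twistedSymbolSum f χ / (plusPeriod f : ℂ)) / 3) := by ring
    rw [hsfχ, this]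
    refine IsIntegral.mul ?_ (hsfint χ hP)
    refine IsIntegral.prod _ (fun χ' _ => ?_)
    exact_mod_cast isIntegral_algebraMap (R := ℤ) (A := ℂ) (x := (sfun χ' : ℤ))
  have hq : (((((ℓ.totient : ℤ) * j * s : ℤ) : ℚ) / 3 : ℚ) : ℂ)
      = ∑ χ : DirichletCharacter ℂ ℓ, c χ * ((s : ℂ) * (twistedSymbolSum f χ / (plusPeriod f : ℂ)) / 3) := by
    have : ∑ χ : DirichletCharacter ℂ ℓ, c χ * ((s : ℂ) * (twistedSymbolSum f χ / (plusPeriod f : ℂ)) / 3)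
        = (∑ χ : DirichletCharacter ℂ ℓ, c χ * twistedSymbolSum f χ) * ((s : ℂ) / (3 * (plusPeriod f : ℂ))) := by
      rw [Finset.sum_mul]
      refine Finset.sum_congr rfl (fun χ _ => ?_)
      field_simp
    rw [this, ← hE]
    push_cast
    field_simp
  have hI : IsIntegral ℤ (((((ℓ.totient : ℤ) * j * s : ℤ) : ℚ) / 3 : ℚ) : ℂ) := by
    rw [hq]
    refine IsIntegral.sum _ (fun χ _ => ?_)
    by_cases hP : P χ
    · exact (hcI χ hP).mul (hint χ hP)
    · rw [hc0 χ hP, zero_mul]; exact isIntegral_zero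
  obtain ⟨y, hy⟩ := Literature.RingTheory.ZeroDimensional.exists_int_of_isIntegral_ratCast hI
  have h3 : (3 : ℤ) ∣ (ℓ.totient : ℤ) * j * s := by
    refine ⟨y, ?_⟩
    have : ((y : ℚ)) * 3 = (((ℓ.totient : ℤ) * j * s : ℤ) : ℚ) := by rw [hy]; field_simp
    exact_mod_cast (by linarith : (((ℓ.totient : ℤ) * j * s : ℤ) : ℚ) = 3 * y)
  rcases Int.prime_three.dvd_mul.mp h3 with h | h
  · rcases Int.prime_three.dvd_mul.mp h with h' | h'
    · exact h3tot h'
    · exact hj3 h'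
  · exact hs3 (Int.natCast_dvd_natCast.mp h)

end Fourier

end Summit.BirchSwinnertonDyer.Rank1Residual.ManinAdditive.KatoCurve

end
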